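import Literature.NumberTheory.ComplexMultiplication.CMTorusIsomorphismClassesMaximalEndomorphismRingCount
import Mathlib.RingTheory.DedekindDomain.Different
import HarnessLib

/-!
# The trace dual of the maximal order in the order series IS Dedekind's complementary module (Mathlib's
# `FractionalIdeal.dual ℤ ℚ 1`); its inverse in `𝓞_K` is the different `differentIdeal ℤ (𝓞 K)`

Layer A3 of the Hodge/CM programme (docs/m5/MAPPING.md §1), junction of the "arbitrary order" series with Mathlib.
In `CMOrderGorenstein` the trace dual `Mᵗ = {x ∈ K : Tr(xM) ⊆ ℤ}` of an over-order `M = MM ≠ 0` of `𝔯 = endOrder (M_μ)`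
is a fractional `𝔯`-ideal `T` (`↑T = Mᵗ`), and `M` is Gorenstein iff `Mᵗ` is invertible in `M` [BuchmannLenstra1994,
Prop. 2.7].  For the maximal order `↑M = 𝓞_K` this is classical: `𝓞_Kᵗ = 𝔆_{𝓞_K|ℤ}` is «Dedekind's complementary module,
or the inverse different» and `𝔇 = 𝔆⁻¹` «the different» [NeukirchANT1999, Ch. III §2 Def. (2.1)].  This file says so
in Lean:

* `extend_eq_dual_one` — along `EndOrder.extend` (`N ↦ N𝓞_K`), `T ↦ FractionalIdeal.dual ℤ ℚ (1 : 𝓘(𝓞_K))`;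
* **`extend_mul_coeIdeal_differentIdeal_eq_one`** — `(T𝓞_K) · 𝔇_{K/ℚ} = 𝓞_K` with Mathlib's `differentIdeal ℤ (𝓞 K)`;
* **`exists_mul_eq_and_coe_eq_differentIdeal`** — inside `ICM(𝔯)`: the `M`-inverse of `T` (which exists, `𝓞_K` being
  Gorenstein, `CMTorusIsomorphismClassesMaximalEndomorphismRingCount`) is the `𝔯`-ideal with the lattice of `𝔇_{K/ℚ}`.

Theorems only (no new definitions, no named facts).

## References
* [NeukirchANT1999] J. Neukirch, *Algebraic Number Theory*, Springer 1999 — Ch. III §2 Def. (2.1) («Dedekind's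
  complementary module, or the inverse different … Its inverse … is called the different»), p. 195.
* [BuchmannLenstra1994] J. A. Buchmann, H. W. Lenstra Jr., *Approximating rings of integers in number fields*,
  JTNB 6 (1994) — §2.6–2.7 («`A` is a Gorenstein ring if it is a maximal order»; (c) `A†` invertible), p. 230.
* [Marseglia2019] S. Marseglia, *Computing the ideal class monoid of an order*, arXiv:1805.09671 — §2 Prop. 2.10 (c),
  §3 («`𝒪_K` is Gorenstein»), p. 5.
-/

noncomputable section

open scoped Classical nonZeroDivisors NumberField Pointwise
open NumberField Module FractionalIdeal

namespace Literature.NumberTheory.ComplexMultiplication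

namespace CMTypeLattice

section InverseDifferent

variable {K : Type} [Field K] [NumberField K]
variable {ι : Type} [Fintype ι] [DecidableEq ι] [Nonempty ι] (μ : Basis ι ℚ K)
variable [IsFractionRing (endOrder (Algebra.leftMulMatrix μ)) K]

omit [NumberField K] [Fintype ι] [DecidableEq ι] [Nonempty ι] [IsFractionRing (endOrder (Algebra.leftMulMatrix μ)) K] in
/-- `↑(1 : 𝓘(𝓞_K)) = 𝓞_K ⊂ K` (bookkeeping). [cite: NeukirchANT1999, Ch. III §2 (before Def. (2.1)), p. 195] -/
theorem coe_one_ringOfIntegers_eq_range :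
    ((1 : FractionalIdeal (𝓞 K)⁰ K) : Set K) = (algebraMap (𝓞 K) K).range := by
  ext x
  rw [SetLike.mem_coe, mem_one_iff, SetLike.mem_coe, RingHom.mem_range]

/-- **The trace dual of the maximal order is an `𝓞_K`-module** (`(𝓞_Kᵗ : 𝓞_Kᵗ) = 𝓞_K`): `𝓞_K · T ⊆ T` for `↑T = Mᵗ`,
`↑M = 𝓞_K`. [cite: BuchmannLenstra1994, §2 Prop. 2.7 (proof: «`A† : A† = A`»), p. 230] -/
theorem forall_mul_mem_traceDual_of_coe_eq_range {M T : FractionalIdeal (endOrder (Algebra.leftMulMatrix μ))⁰ K}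
    (hMM : M * M = M) (hM0 : M ≠ 0) (hMO : (M : Set K) = (algebraMap (𝓞 K) K).range)
    (hT : (T : Submodule (endOrder (Algebra.leftMulMatrix μ)) K) =
      Submodule.traceDual ℤ ℚ (M : Submodule (endOrder (Algebra.leftMulMatrix μ)) K)) :
    ∀ a : 𝓞 K, ∀ n ∈ T, (a : K) * n ∈ T := by
  have hT0 : T ≠ 0 := by
    obtain ⟨T', hT'0, hT'⟩ := exists_coe_eq_traceDual μ hM0
    rwa [← coeToSubmodule_inj.1 (hT'.trans hT.symm)]
  exact (EndOrder.coe_div_self_eq_range_iff hT0).1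
    (by rw [traceDual_div_traceDual_eq_of_mul_self_eq μ hMM hM0 hT0 hT, hMO])

/-- **`𝓞_Kᵗ`, extended to Mathlib's fractional `𝓞_K`-ideals, is Dedekind's complementary module
`𝔆_{𝓞_K|ℤ} = {x ∈ K : Tr(x𝓞_K) ⊆ ℤ} = FractionalIdeal.dual ℤ ℚ 1`** (the inverse different).
[cite: NeukirchANT1999, Ch. III §2 Def. (2.1), p. 195] [cite: BuchmannLenstra1994, §2.3 («`A† = {x ∈ A_F : Tr(xA) ⊂ R}`»), p. 228] -/
theorem extend_eq_dual_one {M T : FractionalIdeal (endOrder (Algebra.leftMulMatrix μ))⁰ K}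
    (hMM : M * M = M) (hM0 : M ≠ 0) (hMO : (M : Set K) = (algebraMap (𝓞 K) K).range)
    (hT : (T : Submodule (endOrder (Algebra.leftMulMatrix μ)) K) =
      Submodule.traceDual ℤ ℚ (M : Submodule (endOrder (Algebra.leftMulMatrix μ)) K)) :
    EndOrder.extend (Algebra.leftMulMatrix μ) T = FractionalIdeal.dual ℤ ℚ (1 : FractionalIdeal (𝓞 K)⁰ K) := by
  have hmemM : ∀ a : K, a ∈ (M : Submodule (endOrder (Algebra.leftMulMatrix μ)) K) ↔
      a ∈ (1 : FractionalIdeal (𝓞 K)⁰ K) := fun a => by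
    rw [mem_coe, ← SetLike.mem_coe, hMO, ← coe_one_ringOfIntegers_eq_range, SetLike.mem_coe]
  apply SetLike.coe_injective
  rw [EndOrder.coe_extend_eq_of_forall_mul_mem (forall_mul_mem_traceDual_of_coe_eq_range μ hMM hM0 hMO hT)]
  ext x
  rw [SetLike.mem_coe, SetLike.mem_coe, mem_dual (one_ne_zero' (FractionalIdeal (𝓞 K)⁰ K)), ← mem_coe, hT,
    Submodule.mem_traceDual]
  exact ⟨fun h a ha => h a ((hmemM a).2 ha), fun h a ha => h a ((hmemM a).1 ha)⟩

/-- **`𝓞_Kᵗ · 𝔇_{K/ℚ} = 𝓞_K`: the trace dual of the maximal order is the inverse of Mathlib's different ideal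
`differentIdeal ℤ (𝓞 K)`** («Its inverse, `𝔇 = 𝔆⁻¹`, is called the different»). [cite: NeukirchANT1999, Ch. III §2
Def. (2.1), p. 195] -/
theorem extend_mul_coeIdeal_differentIdeal_eq_one {M T : FractionalIdeal (endOrder (Algebra.leftMulMatrix μ))⁰ K}
    (hMM : M * M = M) (hM0 : M ≠ 0) (hMO : (M : Set K) = (algebraMap (𝓞 K) K).range)
    (hT : (T : Submodule (endOrder (Algebra.leftMulMatrix μ)) K) =
      Submodule.traceDual ℤ ℚ (M : Submodule (endOrder (Algebra.leftMulMatrix μ)) K)) :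
    EndOrder.extend (Algebra.leftMulMatrix μ) T * ((differentIdeal ℤ (𝓞 K) : Ideal (𝓞 K)) : FractionalIdeal (𝓞 K)⁰ K) = 1 := by
  rw [extend_eq_dual_one μ hMM hM0 hMO hT, coeIdeal_differentIdeal (A := ℤ) (K := ℚ) (L := K) (B := 𝓞 K),
    mul_inv_cancel₀ (dual_ne_zero ℤ ℚ (one_ne_zero' (FractionalIdeal (𝓞 K)⁰ K)))]

/-- **Inside `ICM(𝔯)`: the inverse of `𝓞_Kᵗ` in `𝓞_K` is the different** — there is an `𝔯`-ideal `D`, an `𝓞_K`-module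
(`MD = D`) with `T·D = M` (`𝓞_K` is Gorenstein: `Mᵗ` is invertible in `M`), and its lattice is that of `𝔇_{K/ℚ}`.
[cite: NeukirchANT1999, Ch. III §2 Def. (2.1), p. 195] [cite: BuchmannLenstra1994, §2 Prop. 2.7 ((a)⇔(c)) with §2.6
(«`A` is a Gorenstein ring if it is a maximal order»), p. 230] [cite: Marseglia2019, §2 Prop. 2.10 (c), p. 5] -/
theorem exists_mul_eq_and_coe_eq_differentIdeal {M T : FractionalIdeal (endOrder (Algebra.leftMulMatrix μ))⁰ K}
    (hMM : M * M = M) (hM0 : M ≠ 0) (hMO : (M : Set K) = (algebraMap (𝓞 K) K).range)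
    (hT : (T : Submodule (endOrder (Algebra.leftMulMatrix μ)) K) =
      Submodule.traceDual ℤ ℚ (M : Submodule (endOrder (Algebra.leftMulMatrix μ)) K)) :
    ∃ D : FractionalIdeal (endOrder (Algebra.leftMulMatrix μ))⁰ K, M * D = D ∧ T * D = M ∧
      (D : Set K) = (((differentIdeal ℤ (𝓞 K) : Ideal (𝓞 K)) : FractionalIdeal (𝓞 K)⁰ K) : Set K) := by
  have hT0 : T ≠ 0 := by
    obtain ⟨T', hT'0, hT'⟩ := exists_coe_eq_traceDual μ hM0
    rwa [← coeToSubmodule_inj.1 (hT'.trans hT.symm)]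
  have hMT : M * T = T := (EndOrder.mul_eq_iff_forall_mul_mem_of_coe_eq_range hMO).2
    (forall_mul_mem_traceDual_of_coe_eq_range μ hMM hM0 hMO hT)
  obtain ⟨D, hMD, hTD⟩ := EndOrder.exists_mul_eq_of_coe_eq_range hMO hT0 hMT
  refine ⟨D, hMD, hTD, ?_⟩
  -- `(T𝓞)(D𝓞) = M𝓞 = 𝓞`, so `D𝓞 = (T𝓞)⁻¹ = 𝔇`; and `D𝓞 = D` on lattices
  have hM1 : EndOrder.extend (Algebra.leftMulMatrix μ) M = 1 :=
    EndOrder.extend_eq_of_coe_eq (hMO.trans coe_one_ringOfIntegers_eq_range.symm)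
  have hD : EndOrder.extend (Algebra.leftMulMatrix μ) D =
      ((differentIdeal ℤ (𝓞 K) : Ideal (𝓞 K)) : FractionalIdeal (𝓞 K)⁰ K) := by
    rw [coeIdeal_differentIdeal (A := ℤ) (K := ℚ) (L := K) (B := 𝓞 K), ← extend_eq_dual_one μ hMM hM0 hMO hT]
    exact eq_inv_of_mul_eq_one_right (by rw [← map_mul, hTD, hM1])
  rw [← hD, EndOrder.coe_extend_eq_of_forall_mul_mem ((EndOrder.mul_eq_iff_forall_mul_mem_of_coe_eq_range hMO).1 hMD)]

end InverseDifferent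

end CMTypeLattice

end Literature.NumberTheory.ComplexMultiplication
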